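import Summits.ABC.ABC.Theorems.DefiniteXiDefiniteRTControlPrime
import Summits.ABC.ABC.Theorems.SteinbergCore.Negative.SteinbergCoreDomain
import Summits.ABC.ABC.Theorems.MazurKenkuBound.Negative.StrongForm
import Literature.NumberTheory.EllipticCurves.CuspFormLFunction
import Summits.ABC.ABC.Theorems.RibetTakahashiSplitManyPrimeValuationProductCensusConverses
import HarnessLib

/-!
# Route DefiniteXi, crux `SteinbergCore` (stmt-ABC-15024), line `p6_tamagawa_split`:
# the `ξ`-versus-degree comparison at PRIME type, from the named facts

The crux `SteinbergCore` bounds `cps ξ(E; N/Nm, Nm) · T(E)` by `C_ε N^(2+ε)` for the Frey curves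
`E = freyCurve a b` (`ξ = brandtXi`, `cps n = n / (2^{v₂ n} 3^{v₃ n})` the prime-to-`6` part,
`T(E) = ∏_{p ∣ N} v_p(Δ_min E)`).  The line `p6_tamagawa_split` splits it as
(comparison `ξ`-vs-degree) × (degree conjecture away from `6`) × (`T`-allowance).  This file proves
the comparison at PRIME type `Nm = q` (`q` an odd prime of the conductor),
`xiDegreeComparison_prime_of_facts`:

`cps ξ(N/q; q) ≤ C · N^ε · cps (deg D) · T(E)³` for a datum `D` of minimal degree of the Frey model,

CONDITIONALLY on the three named facts `takahashi2001_thm_2_3_of_coprime` (Takahashi 2001,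
Thm. 2.3 at `r ∥ N`), `PastenShimura2024_minimalDegree_le_163_mul` (Pasten 2024 §3 p. 13, the
Mazur–Kenku degree transport), `PastenShimura2024_lemma_6_8` (Pasten 2024, Lemma 6.8) and on the
route item `FreyModularity` (existence of data for the Frey model).  It is the reverse direction of
`Summit.ABC.ABC.Theorems.DefiniteRTControlPrime.definiteRTControlPrime_of_facts`, run through the
same two pivots (the lattice-optimal datum `D₀` of the class, `exists_optimalDatum'`, and the
conductor-restricted optimal datum `P⋆`, `exists_conductorMinimal`).

## Composition (`C = 4 · 163²`; the `N^ε` is idle; `T ≤ T³` from `1 ≤ T`)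

Write `N = M q`, `gcd(M, q) = 1` (`stub_freyLocal`).  Let `D` be a minimal datum of `E`
(`FreyModularity`, `exists_minimal_datum`), `D₀` the optimal datum of the class of `D.f`,
`(W⋆, P⋆)` the conductor-restricted pivot, `S` a Brandt setup of type `(M, q)`
(`takahashi2001_thm_2_3_of_coprime.nonempty_xiSetup'`; `brandtXi M q = S.xi`).  Takahashi gives
`i, j` with `0 < i`, `i j = c_q(W⋆)`, `deg P⋆ · i = ξ · j` (`a(W⋆) = a(E)`), so `j ≠ 0` and
`cps ξ ≤ cps (ξ j) = cps (deg P⋆ · i)`.  With `δ₀ := deg D₀`, class-minimality gives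
`δ₀ ∣ deg P⋆ = δ₀ m⋆`, `δ₀ ∣ deg D = δ₀ m_E` (`modularDegree_dvd_of_classMinimal`), and
conductor-minimality of `P⋆` gives `m⋆ ≤ m_E`; the global minimal model `C • E` with its minimal
datum `D₁` (same newform, `IsNewformOf.unique` + `LFunction_smul`) gives
`deg D ≤ (num u_C)² deg D₁ ≤ 4 · 163 · δ₀` (`stub_smulTransportDeg`, `stub_freyScale`, the
`163`-fact), i.e. `m_E ≤ 4 · 163`.  Finally `i ≤ i j = c_q(W⋆) ≤ 163 c_q(E) ≤ 163 T`
(`stub_valTransport`; each factor of `T` is `≥ 1`,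
`ManyPrimeValuationProduct.one_le_factorization_of_mem_primeFactors_conductorNorm`), and
multiplicativity of `cps` yields
`cps ξ ≤ cps δ₀ · m⋆ · i ≤ cps (deg D) · (4 · 163) · (163 T)` (`primeToSix_chain`).

## References

* [Takahashi2001] S. Takahashi, J. Number Theory 90 (2001) 74–88, Thm. 2.3 (p. 79), p. 80.
* [PastenShimura2024] H. Pasten, Shimura curves and the abc conjecture, J. Number Theory 254 (2024)
  = arXiv:1705.09251, §3 p. 13, Lemma 6.8 p. 22.
* [Mazur1978] B. Mazur, Invent. Math. 44 (1978); [Kenku1982] M. A. Kenku, J. Number Theory 15 (1982).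
-/

set_option linter.dupNamespace false

noncomputable section

namespace Summit.ABC.ABC.Theorems

open Summit.ABC.ABC.Theses.DefiniteXi
open Literature.NumberTheory.EllipticCurves Literature.NumberTheory.EllipticCurves.ModularForms
open Literature.NumberTheory.Automorphic
open WeierstrassCurve
open Summit.ABC.ABC.Theorems.DefiniteRTControlPrime
open Summit.ABC.ABC.Theorems.SteinbergCore.Negative
open Summit.ABC.ABC.Theorems.MazurKenkuBound.Negative

namespace XiDegreeComparisonPrime

/-! ## Helpers: the `cps` chain, the passage to `ℝ` -/

/-- **The `cps` chain in `ℕ`.** From Takahashi's `deg P⋆ · i = ξ · j` (`j ≠ 0`), the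
factorisations `deg P⋆ = δ₀ m⋆`, `deg D = δ₀ m_E` (`m_E ≠ 0`) and the bounds `m⋆ ≤ 4 · 163`,
`i ≤ 163 T`: `cps ξ ≤ cps (ξ j) = cps δ₀ · cps (m⋆ i) ≤ cps δ₀ · cps m_E · m⋆ i
= cps (deg D) · m⋆ i ≤ 4 · 163² · cps (deg D) · T` (`cps` is multiplicative, `cps n ≤ n`,
`1 ≤ cps n ↔ n ≠ 0`). [folklore] -/
theorem primeToSix_chain {ξ j P δ₀ ms mE d i T : ℕ} (hδ : P * i = ξ * j) (hj : j ≠ 0)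
    (hP : P = δ₀ * ms) (hd : d = δ₀ * mE) (hmE0 : mE ≠ 0) (hms : ms ≤ 4 * 163)
    (hi : i ≤ 163 * T) :
    ξ / (ordProj[2] ξ * ordProj[3] ξ) ≤ 4 * 163 * 163 * (d / (ordProj[2] d * ordProj[3] d)) * T :=
  calc ξ / (ordProj[2] ξ * ordProj[3] ξ)
      ≤ ξ * j / (ordProj[2] (ξ * j) * ordProj[3] (ξ * j)) := primeToSix_le_primeToSix_mul hj
    _ = δ₀ * (ms * i) / (ordProj[2] (δ₀ * (ms * i)) * ordProj[3] (δ₀ * (ms * i))) := by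
        rw [← hδ, hP, mul_assoc]
    _ = δ₀ / (ordProj[2] δ₀ * ordProj[3] δ₀) *
          (ms * i / (ordProj[2] (ms * i) * ordProj[3] (ms * i))) := primeToSix_mul _ _
    _ ≤ δ₀ / (ordProj[2] δ₀ * ordProj[3] δ₀) * (ms * i) :=
        Nat.mul_le_mul_left _ (primeToSix_le _)
    _ ≤ δ₀ / (ordProj[2] δ₀ * ordProj[3] δ₀) * (mE / (ordProj[2] mE * ordProj[3] mE)) * (ms * i) :=
        Nat.mul_le_mul_right _
          (Nat.le_mul_of_pos_right _ ((one_le_primeToSix_iff mE).mpr hmE0))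
    _ = δ₀ * mE / (ordProj[2] (δ₀ * mE) * ordProj[3] (δ₀ * mE)) * (ms * i) := by
        rw [primeToSix_mul]
    _ = d / (ordProj[2] d * ordProj[3] d) * (ms * i) := by rw [hd]
    _ ≤ d / (ordProj[2] d * ordProj[3] d) * (4 * 163 * (163 * T)) :=
        Nat.mul_le_mul_left _ (Nat.mul_le_mul hms hi)
    _ = 4 * 163 * 163 * (d / (ordProj[2] d * ordProj[3] d)) * T := by ring

/-- **Passage to `ℝ`**, inserting the idle `N^ε ≥ 1` and `T ≤ T³` (`1 ≤ T`). [folklore] -/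
theorem cast_le_of_chain {x y T N : ℕ} {ε : ℝ} (hε : 0 < ε) (hN : N ≠ 0) (hT : 1 ≤ T)
    (h : x ≤ 4 * 163 * 163 * y * T) :
    (x : ℝ) ≤ 4 * 163 * 163 * (N : ℝ) ^ ε * (y : ℝ) * (T : ℝ) ^ 3 := by
  have hN1 : (1 : ℝ) ≤ (N : ℝ) := by exact_mod_cast Nat.one_le_iff_ne_zero.mpr hN
  have hrpow : (1 : ℝ) ≤ (N : ℝ) ^ ε := Real.one_le_rpow hN1 hε.le
  have hT1 : (1 : ℝ) ≤ (T : ℝ) := by exact_mod_cast hT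
  have hT3 : (T : ℝ) ≤ (T : ℝ) ^ 3 := le_self_pow₀ hT1 (by norm_num)
  have hcast : (x : ℝ) ≤ 4 * 163 * 163 * (y : ℝ) * (T : ℝ) := by exact_mod_cast h
  calc (x : ℝ) ≤ 4 * 163 * 163 * (y : ℝ) * (T : ℝ) := hcast
    _ ≤ 4 * 163 * 163 * (y : ℝ) * (T : ℝ) ^ 3 := by gcongr
    _ = 4 * 163 * 163 * 1 * (y : ℝ) * (T : ℝ) ^ 3 := by ring
    _ ≤ 4 * 163 * 163 * (N : ℝ) ^ ε * (y : ℝ) * (T : ℝ) ^ 3 := by gcongr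

end XiDegreeComparisonPrime

open XiDegreeComparisonPrime

/-! ## The comparison at prime type from the named facts -/

/-- **The `ξ`-versus-degree comparison at prime type `Nm = q`, from the named facts** (Takahashi
2001 Thm. 2.3 at `r ∥ N`; Pasten 2024 §3 p. 13 = Mazur–Kenku degree transport; Pasten 2024
Lemma 6.8; existence of data for the Frey model): for every `ε > 0`, with `C = 4 · 163²`, for all
coprime `a, b` with `ab(a+b) ≠ 0`, `N` the conductor of `E = freyCurve a b`, every odd prime
`q ∣ N` (the guard `ξ ≠ 0` is not used), there is a datum `D` of minimal degree of the model `E` at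
level `N` with `cps ξ(N/q; q)(a(E)) ≤ C · N^ε · cps (deg D) · T(E)³`.  See the module docstring for
the chain `cps ξ ≤ cps (deg P⋆ · i) ≤ cps δ₀ · m⋆ · i ≤ cps (deg D) · (4·163) · (163 T)`.
CONDITIONAL on exactly the four hypotheses; everything else is proved in the tree.
[cite: Takahashi2001, Thm. 2.3 (p. 79), remark p. 80]
[cite: PastenShimura2024, §3 p. 13 and Lemma 6.8 (p. 22)] -/
theorem xiDegreeComparison_prime_of_facts :
    Literature.NumberTheory.EllipticCurves.takahashi2001_thm_2_3_of_coprime →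
    Literature.NumberTheory.EllipticCurves.ModularForms.PastenShimura2024_minimalDegree_le_163_mul →
    Literature.NumberTheory.EllipticCurves.ModularForms.PastenShimura2024_lemma_6_8 →
    Summit.ABC.ABC.Theses.DefiniteXi.FreyModularity →
    ∀ ε : ℝ, 0 < ε → ∃ C : ℝ, ∀ a b : ℤ, IsCoprime a b → a * b * (a + b) ≠ 0 → ∀ (N : ℕ) [NeZero N],
      (Literature.NumberTheory.EllipticCurves.freyCurve a b).conductorNorm ℤ = N →
      ∀ q : ℕ, q.Prime → q ≠ 2 → q ∣ N →
      Literature.NumberTheory.Automorphic.brandtXi (N / q) q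
          (fun n => (Literature.NumberTheory.EllipticCurves.freyCurve a b).LFunction n) ≠ 0 →
      ∃ D : Literature.NumberTheory.EllipticCurves.ModularForms.ModularParametrizationData
        (Literature.NumberTheory.EllipticCurves.freyCurve a b) N,
        (∀ D' : Literature.NumberTheory.EllipticCurves.ModularForms.ModularParametrizationData
          (Literature.NumberTheory.EllipticCurves.freyCurve a b) N, D.deg ≤ D'.deg) ∧
        ((Literature.NumberTheory.Automorphic.brandtXi (N / q) q
              (fun n => (Literature.NumberTheory.EllipticCurves.freyCurve a b).LFunction n) /
            (ordProj[2] (Literature.NumberTheory.Automorphic.brandtXi (N / q) q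
                (fun n => (Literature.NumberTheory.EllipticCurves.freyCurve a b).LFunction n)) *
              ordProj[3] (Literature.NumberTheory.Automorphic.brandtXi (N / q) q
                (fun n => (Literature.NumberTheory.EllipticCurves.freyCurve a b).LFunction n))) : ℕ) : ℝ) ≤
          C * (N : ℝ) ^ ε * ((D.deg / (ordProj[2] D.deg * ordProj[3] D.deg) : ℕ) : ℝ) *
            ((∏ p ∈ N.primeFactors, ((Literature.NumberTheory.EllipticCurves.freyCurve a b).minimalDiscriminantNorm
              ℤ).factorization p : ℕ) : ℝ) ^ 3 := by
  intro hT h163 h68 hFM ε hε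
  refine ⟨4 * 163 * 163, ?_⟩
  intro a b hab h0 N _ hN q hq hq2 hqN _hξ
  -- `N = M q`
  obtain ⟨M, hM⟩ := hqN
  rw [mul_comm] at hM
  subst hM
  haveI := isElliptic_freyCurve h0
  have hdiv : M * q / q = M := Nat.mul_div_cancel M hq.pos
  have hqN' : q ∣ (freyCurve a b).conductorNorm ℤ := by rw [hN]; exact Dvd.intro_left M rfl
  -- `gcd(M, q) = 1`
  have hcop : M.Coprime q := by
    have h := stub_freyLocal a b hab h0 q hq hq2 hqN'
    rwa [hN, hdiv] at h
  -- a datum `D` of minimal degree of the Frey model: the witness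
  obtain ⟨D, -, hDmin⟩ := exists_minimal_datum (hFM a b hab h0 (M * q) hN)
  refine ⟨D, hDmin, ?_⟩
  -- the lattice-optimal datum `D₀` of the class of `f := D.f`
  obtain ⟨W₀, hW₀, D₀, hf₀, h₀⟩ := D.exists_optimalDatum'
  haveI := hW₀
  have hker₀ : D₀.isogenyMap.ker = ⊥ := D₀.isogenyMap_ker_eq_bot_iff.mpr h₀
  have hmin₀ : ∀ (W' : WeierstrassCurve ℚ) [W'.IsElliptic]
      (D' : ModularParametrizationData W' (M * q)), D'.f = D₀.f →
        D₀.modularDegree ≤ D'.modularDegree := fun W' _ D' hD' =>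
    D₀.modularDegree_le_of_isogenyMap_ker_eq_bot hker₀ D' hD'
  -- the conductor-restricted optimal pivot `(W⋆, P⋆)`
  obtain ⟨Ws, hWs, Ps, hNs, hfs, hPsmin⟩ := exists_conductorMinimal D hN
  haveI := hWs
  -- Takahashi at `(W⋆, P⋆)` in a Brandt setup `S` of type `(M, q)`
  obtain ⟨S⟩ := takahashi2001_thm_2_3_of_coprime.nonempty_xiSetup' (M := M) hq hcop
  obtain ⟨i, j, hi, hij, -, hδ⟩ := hT Ws M q hq hcop hNs Ps hPsmin S
  -- `a(W⋆) = a(E)`, and the setup computes `brandtXi`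
  have hL : (fun n => Ws.LFunction n) = fun n => (freyCurve a b).LFunction n := by
    funext n
    have h1 := Ps.isNewformOf.2 n
    have h2 := D.isNewformOf.2 n
    rw [hfs] at h1
    rw [h1] at h2
    exact_mod_cast h2
  have hδ' : Ps.modularDegree * i =
      brandtXi (M * q / q) q (fun n => (freyCurve a b).LFunction n) * j := by
    rw [hdiv, Brandt.XiSetup.brandtXi_eq_xi S, ← hL]
    exact hδ
  -- `j ≠ 0`
  have hj : j ≠ 0 := by
    rintro rfl
    rw [mul_zero] at hδ
    exact (Nat.mul_pos Ps.deg_pos hi).ne' hδ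
  -- `δ₀ ∣ deg P⋆`, `δ₀ ∣ deg D`
  have hδ₀pos : 0 < D₀.modularDegree := D₀.deg_pos
  obtain ⟨ms, hms⟩ : D₀.modularDegree ∣ Ps.modularDegree :=
    modularDegree_dvd_of_classMinimal D₀ Ps (hfs.trans hf₀.symm) hmin₀
  obtain ⟨mE, hmE⟩ : D₀.modularDegree ∣ D.deg :=
    modularDegree_dvd_of_classMinimal D₀ D hf₀.symm hmin₀
  -- `deg P⋆ ≤ deg D` (conductor-minimality of `P⋆` at `(E, D)`), so `m⋆ ≤ m_E`
  have hPsD : Ps.modularDegree ≤ D.deg := hPsmin (freyCurve a b) hN D hfs.symm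
  have hms_le : ms ≤ mE := by
    refine Nat.le_of_mul_le_mul_left ?_ hδ₀pos
    rw [← hms, ← hmE]
    exact hPsD
  have hmE0 : mE ≠ 0 := by
    rintro rfl
    rw [mul_zero] at hmE
    exact D.deg_pos.ne' hmE
  -- `m_E ≤ 4 · 163` through the global minimal model `C • E`
  obtain ⟨Cv, hCv⟩ := hasGlobalMinimalModel_rat_holds (freyCurve a b)
  haveI := hCv
  have hne : Nonempty (ModularParametrizationData (Cv • freyCurve a b) (M * q)) :=
    (Summit.ABC.ABC.Theorems.nonempty_modularParametrizationData_smul_iff Cv).mpr ⟨D⟩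
  obtain ⟨D₁, -, hD₁min⟩ := exists_minimal_datum hne
  have hf₁ : D₁.f = D.f := by
    refine IsNewformOf.unique (W := freyCurve a b) ⟨D₁.isNewformOf.1, fun n => ?_⟩ D.isNewformOf
    rw [D₁.isNewformOf.2 n, LFunction_smul]
  have h163' : D₁.modularDegree ≤ 163 * D₀.modularDegree :=
    h163 (M * q) W₀ (Cv • freyCurve a b) D₀ D₁ (hf₁.trans hf₀.symm) hmin₀ hD₁min
  obtain ⟨D₁', -, hdeg₁'⟩ := stub_smulTransportDeg Cv D₁
  have hscale : (Cv.u : ℚ).num.natAbs ≤ 2 := stub_freyScale a b hab h0 Cv hCv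
  have hD4 : D.deg ≤ 4 * (163 * D₀.modularDegree) :=
    calc D.deg ≤ D₁'.deg := hDmin D₁'
      _ = (Cv.u : ℚ).num.natAbs ^ 2 * D₁.deg := hdeg₁'
      _ ≤ 2 ^ 2 * D₁.deg := Nat.mul_le_mul_right _ (Nat.pow_le_pow_left hscale 2)
      _ ≤ 2 ^ 2 * (163 * D₀.modularDegree) := Nat.mul_le_mul_left _ h163'
      _ = 4 * (163 * D₀.modularDegree) := by norm_num
  have hmE_le : mE ≤ 4 * 163 := by
    refine Nat.le_of_mul_le_mul_left ?_ hδ₀pos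
    calc D₀.modularDegree * mE = D.deg := hmE.symm
      _ ≤ 4 * (163 * D₀.modularDegree) := hD4
      _ = D₀.modularDegree * (4 * 163) := by ring
  -- `i ≤ i j = c_q(W⋆) ≤ 163 c_q(E) ≤ 163 T`, and `1 ≤ T`
  have hiso : (freyCurve a b).IsIsogenous Ws := isIsogenous_of_f_eq D Ps hfs
  have hval : (Ws.minimalDiscriminantNorm ℤ).factorization q ≤
      163 * ((freyCurve a b).minimalDiscriminantNorm ℤ).factorization q :=
    stub_valTransport h68 a b hab h0 q hq hq2 hqN' Ws hiso
  have hqmem : q ∈ (M * q).primeFactors :=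
    Nat.mem_primeFactors.mpr ⟨hq, Dvd.intro_left M rfl, NeZero.ne _⟩
  have hfac1 : ∀ p ∈ (M * q).primeFactors,
      1 ≤ ((freyCurve a b).minimalDiscriminantNorm ℤ).factorization p := by
    intro p hp
    rw [← hN] at hp
    exact ManyPrimeValuationProduct.one_le_factorization_of_mem_primeFactors_conductorNorm
      (freyCurve a b) hp
  have h1T : 1 ≤ ∏ p ∈ (M * q).primeFactors,
      ((freyCurve a b).minimalDiscriminantNorm ℤ).factorization p :=
    Finset.one_le_prod' hfac1
  have hi_le : i ≤ 163 * ∏ p ∈ (M * q).primeFactors,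
      ((freyCurve a b).minimalDiscriminantNorm ℤ).factorization p :=
    calc i ≤ i * j := Nat.le_mul_of_pos_right _ (Nat.pos_of_ne_zero hj)
      _ = (Ws.minimalDiscriminantNorm ℤ).factorization q := hij
      _ ≤ 163 * ((freyCurve a b).minimalDiscriminantNorm ℤ).factorization q := hval
      _ ≤ 163 * ∏ p ∈ (M * q).primeFactors,
            ((freyCurve a b).minimalDiscriminantNorm ℤ).factorization p :=
          Nat.mul_le_mul_left _ (Finset.single_le_prod' hfac1 hqmem)
  -- assemble: the `cps` chain in `ℕ`, then to `ℝ`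
  exact cast_le_of_chain hε (NeZero.ne (M * q)) h1T
    (primeToSix_chain hδ' hj hms hmE hmE0 (hms_le.trans hmE_le) hi_le)

end Summit.ABC.ABC.Theorems

end
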